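import Mathlib
import HarnessLib
import Summits.HubbardSuperconductivity.HubbardSuperconductivity.Theorems.KLProgrammeKLRegimeSplitBundleV10
import Summits.HubbardSuperconductivity.HubbardSuperconductivity.Theorems.KLProgrammeKLRegimeSplitValueIdentification
import Summits.HubbardSuperconductivity.HubbardSuperconductivity.Theorems.KLProgrammeKLRegimeEngineSelfEnergySymmetric

/-!
# Route `KLProgramme` — crux K3, ENGINE child (gen 3: `KLRegimeEngineV11 := EngineP4 klPredsV11 klWindowC`; engine slot of record
# `EngineBoundsAtV7S`, `KLProgrammeKLRegimeSplitBundleV10.lean`): the engine slot REDUCED to its analytic conjuncts, scale by scale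

Cell gate-hubbard-kl, seat p3 (g5); bookkeeping for the engine skeleton (`stub_engine_scale0`, `stub_engine_step_*`, owner k3c2-p1).

`EngineBoundsAtV7S … n = (E0) SelfEnergySymmetric ∧ (E1-v4) KernelNormsV4 ∧ (E2-v7) PairLadderStepAtV7 ∧ (E2″-v6) PairValueIncrementAtV6 ∧
(E2′-S3) QuarticValueIncrementAtS3 ∧ (E2′-S2 UV) QuarticValueUVAtS2 ∧ (E4) EngineFirstMoments ∧ (E5-S) IsoTupleL1AtS`.  Three observations, all
hypothesis-free:

* (E0) holds at EVERY scale (`selfEnergySymmetric_all`, p3 g4, `KLProgrammeKLRegimeEngineSelfEnergySymmetric.lean`);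
* at `n = 0` the three increment clauses (E2-v7).2, (E2″-v6), (E2′-S3) are vacuous (`1 ≤ 0` is false), and at `1 ≤ n` the two ultraviolet
  clauses (E2-v7).1, (E2′-S2 UV) are vacuous (`n = 0` is false);
* **(E2′-S2 UV) is a corollary of (E2-v7).1**: the `↑↓` running coupling value at `(k₁, k₂, k₃)` IS the pair amplitude at total momentum
  `k₁ + k₃` read at `(k₂, k₁)` (`klka_quarticValue_eq_pairAmplitude` of `KLProgrammeKLRegimeSplitValueIdentification.lean`, an even leg permutation), so
  `‖λ₀^{↑↓}(k₁,k₂,k₃)‖ ≤ ‖𝒞₀(k₁+k₃; k₂, k₁) − U‖ + |U| ≤ |U| + initDevBar G U + legDressBarQ G P Q U 0 4` — for every `k₃` (its ball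
  membership is not used).

Hence (`engineBoundsAtV7S_zero_iff`) **the scale-`0` rung `EngineBoundsAtV7S … 0` is EQUIVALENT to the conjunction of exactly four analytic
clauses** — (E1-v4) `KernelNormsV4 … 0`, the pair-amplitude ultraviolet clause (= (E2-v7).1's consequent: `∀ Q, ∀ k k′ ∈ klBall, ‖𝒞₀(Q;k,k′) − U‖ ≤ initDevBar G U + legDressBarQ G P Q U 0 4`),
(E4) `EngineFirstMoments … 0`, (E5-S) `IsoTupleL1AtS … 0` — and (`engineBoundsAtV7S_of_pos`) at `1 ≤ n` it follows from (E1-v4), the pair-ladder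
step, the two increment clauses, (E4) and (E5-S), with nothing to prove for (E0) or the ultraviolet values.  Pure bookkeeping over landed
definitions; nothing about the model is asserted.
-/

noncomputable section

namespace Summit.HubbardSuperconductivity.HubbardSuperconductivity.Theorems.KLRegimeSplit

set_option linter.dupNamespace false -- summit = problem name (single-conjunct summit), D-0017

open Literature.MathematicalPhysics.QuantumLattice Literature.Probability.LatticeModels
open Summit.HubbardSuperconductivity.HubbardSuperconductivity.Theorems.KLProgrammeLegKernels

section Model

variable {L M : ℕ} [NeZero L] [NeZero M]

/-- (E2-v7) at scale `0` IS the pair-amplitude ultraviolet clause (its `1 ≤ 0` conjunct is vacuous). -/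
theorem pairLadderStepAtV7_zero_iff (G : GeoConsts) (P : SplitConsts) (Q : EngConsts) (β U μ : ℝ) (K : TrigPolyC4v) :
    PairLadderStepAtV7 L M G P Q β U μ K 0 ↔
      (∀ Qm : TorusSite 2 L, ∀ k ∈ klBall L μ K, ∀ k' ∈ klBall L μ K,
        ‖klPairAmplitude L M β U μ K 0 Qm k k' - (U : ℂ)‖ ≤ initDevBar G U + legDressBarQ G P Q U 0 4) := by
  constructor
  · exact fun h => h.1 rfl
  · exact fun h => ⟨fun _ => h, fun h1 => absurd h1 (by omega)⟩

/-- (E2-v7) at a scale `1 ≤ n` from its inductive conjunct alone (the ultraviolet conjunct is vacuous). -/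
theorem pairLadderStepAtV7_of_pos {G : GeoConsts} {P : SplitConsts} {Q : EngConsts} {β U μ : ℝ} {K : TrigPolyC4v} {n : ℕ}
    (hn : 1 ≤ n)
    (h : ∀ Qm : TorusSite 2 L, IsPairClassAt L Qm n →
      ∃ w : TorusSite 2 L → ℝ, (∀ p, 0 ≤ w p) ∧ (∑ p, w p ≤ G.bhi) ∧
        ∃ N : Matrix (TorusSite 2 L) (TorusSite 2 L) ℂ,
          (1 + Matrix.diagonal (fun p => (w p : ℂ)) * klPairArray L M β U μ K (n - 1) Qm) * N = 1 ∧
          ∀ k ∈ klBall L μ K, ∀ k' ∈ klBall L μ K,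
            ‖klPairAmplitude L M β U μ K n Qm k k' - (klPairArray L M β U μ K (n - 1) Qm * N) k k'‖ ≤
              drivePBar G P U (n - 1) + eremBar G P Q U β L (n - 1) + thermalBar G P U β n +
                legDressBarQ G P Q U n (legSliceCountT L β μ K n ![k', Qm - k', Qm - k, k])) :
    PairLadderStepAtV7 L M G P Q β U μ K n :=
  ⟨fun h0 => absurd h0 (by omega), fun _ => h⟩

/-- **(E2′-S2 UV) is a corollary of (E2-v7)**: `PairLadderStepAtV7 … n → QuarticValueUVAtS2 … n` at every scale (content at `n = 0`:
`‖λ₀^{↑↓}(k₁,k₂,k₃)‖ ≤ ‖𝒞₀(k₁+k₃; k₂, k₁) − U‖ + |U|`). -/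
theorem quarticValueUVAtS2_of_pairLadderStepAtV7 {G : GeoConsts} {P : SplitConsts} {Q : EngConsts} {β U μ : ℝ} {K : TrigPolyC4v}
    {n : ℕ} (h : PairLadderStepAtV7 L M G P Q β U μ K n) : QuarticValueUVAtS2 L M G P Q β U μ K n := by
  intro hn k₁ hk₁ k₂ hk₂ k₃ _hk₃
  have hU : ‖(U : ℂ)‖ ≤ |U| := by simp
  have h' := klka_quarticValue_le_of_pairArray L M (n := 0) (B₁ := |U|)
    (B₂ := initDevBar G U + legDressBarQ G P Q U 0 4) (fun Qm => ⟨(U : ℂ), hU, h.1 hn Qm⟩) hk₁ hk₂ k₃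
  simpa only [add_assoc] using h'

/-- The pair-amplitude ultraviolet clause gives (E2′-S2 UV) at scale `0`. -/
theorem quarticValueUVAtS2_zero_of_pairAmplitudeUVClause {G : GeoConsts} {P : SplitConsts} {Q : EngConsts} {β U μ : ℝ}
    {K : TrigPolyC4v}
    (h : ∀ Qm : TorusSite 2 L, ∀ k ∈ klBall L μ K, ∀ k' ∈ klBall L μ K,
      ‖klPairAmplitude L M β U μ K 0 Qm k k' - (U : ℂ)‖ ≤ initDevBar G U + legDressBarQ G P Q U 0 4) :
    QuarticValueUVAtS2 L M G P Q β U μ K 0 :=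
  quarticValueUVAtS2_of_pairLadderStepAtV7 ((pairLadderStepAtV7_zero_iff G P Q β U μ K).2 h)

/-! ## The scale-`0` rung -/

/-- **The scale-`0` rung from its four analytic clauses**: (E1-v4) kernel norms at scale `0`, the pair-amplitude ultraviolet clause,
(E4) first moments at scale `0`, (E5-S) iso fixed-tuple `L¹` at scale `0` ⟹ `EngineBoundsAtV7S … 0` — (E0) is `selfEnergySymmetric_all`,
the increment clauses are vacuous, (E2′-S2 UV) is the corollary above. -/
theorem engineBoundsAtV7S_zero_of {G : GeoConsts} {P : SplitConsts} {Q : EngConsts} {β U μ : ℝ} {K : TrigPolyC4v}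
    (hE1 : KernelNormsV4 L M P Q β U μ K 0)
    (hUV : ∀ Qm : TorusSite 2 L, ∀ k ∈ klBall L μ K, ∀ k' ∈ klBall L μ K,
      ‖klPairAmplitude L M β U μ K 0 Qm k k' - (U : ℂ)‖ ≤ initDevBar G U + legDressBarQ G P Q U 0 4)
    (hE4 : EngineFirstMoments L M G P Q β U μ K 0) (hE5 : IsoTupleL1AtS L M G P β U μ K 0) :
    EngineBoundsAtV7S L M G P Q β U μ K 0 :=
  have hE2 : PairLadderStepAtV7 L M G P Q β U μ K 0 := (pairLadderStepAtV7_zero_iff G P Q β U μ K).2 hUV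
  ⟨selfEnergySymmetric_all L M β U μ K 0, hE1, hE2, fun h1 => absurd h1 (by omega), fun h1 => absurd h1 (by omega),
    quarticValueUVAtS2_of_pairLadderStepAtV7 hE2, hE4, hE5⟩

/-- **`EngineBoundsAtV7S … 0` ⟺ (E1-v4)₀ ∧ (pair-amplitude UV clause) ∧ (E4)₀ ∧ (E5-S)₀** — the exact content of `stub_engine_scale0`'s
engine half. -/
theorem engineBoundsAtV7S_zero_iff (G : GeoConsts) (P : SplitConsts) (Q : EngConsts) (β U μ : ℝ) (K : TrigPolyC4v) :
    EngineBoundsAtV7S L M G P Q β U μ K 0 ↔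
      KernelNormsV4 L M P Q β U μ K 0 ∧
        (∀ Qm : TorusSite 2 L, ∀ k ∈ klBall L μ K, ∀ k' ∈ klBall L μ K,
        ‖klPairAmplitude L M β U μ K 0 Qm k k' - (U : ℂ)‖ ≤ initDevBar G U + legDressBarQ G P Q U 0 4) ∧
          EngineFirstMoments L M G P Q β U μ K 0 ∧ IsoTupleL1AtS L M G P β U μ K 0 := by
  constructor
  · exact fun h => ⟨h.2.1, (pairLadderStepAtV7_zero_iff G P Q β U μ K).1 h.2.2.1, h.2.2.2.2.2.2.1, h.2.2.2.2.2.2.2⟩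
  · exact fun h => engineBoundsAtV7S_zero_of h.1 h.2.1 h.2.2.1 h.2.2.2

/-- **The registered stub's shape** (`stub_engine_scale0` of the gen-3 engine skeleton on stmt-…-19823 concludes
`KernelNormsV4 … 0 ∧ PairLadderStepAtV7 … 0 ∧ QuarticValueUVAtS2 … 0 ∧ EngineFirstMoments … 0 ∧ IsoTupleL1AtS … 0`): that five-clause
conjunction from the FOUR analytic clauses — the ultraviolet values clause is not owed separately. -/
theorem engineScaleZeroConj_of {G : GeoConsts} {P : SplitConsts} {Q : EngConsts} {β U μ : ℝ} {K : TrigPolyC4v}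
    (hE1 : KernelNormsV4 L M P Q β U μ K 0)
    (hUV : ∀ Qm : TorusSite 2 L, ∀ k ∈ klBall L μ K, ∀ k' ∈ klBall L μ K,
      ‖klPairAmplitude L M β U μ K 0 Qm k k' - (U : ℂ)‖ ≤ initDevBar G U + legDressBarQ G P Q U 0 4)
    (hE4 : EngineFirstMoments L M G P Q β U μ K 0) (hE5 : IsoTupleL1AtS L M G P β U μ K 0) :
    KernelNormsV4 L M P Q β U μ K 0 ∧ PairLadderStepAtV7 L M G P Q β U μ K 0 ∧ QuarticValueUVAtS2 L M G P Q β U μ K 0 ∧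
      EngineFirstMoments L M G P Q β U μ K 0 ∧ IsoTupleL1AtS L M G P β U μ K 0 :=
  ⟨hE1, (pairLadderStepAtV7_zero_iff G P Q β U μ K).2 hUV, quarticValueUVAtS2_zero_of_pairAmplitudeUVClause hUV, hE4, hE5⟩

/-- The registered stub's five-clause conjunction at scale `0` gives the slot `EngineBoundsAtV7S … 0` (how `KLRegimeEngineV11_of` reads it,
restated here so that either shape can be cited). -/
theorem engineBoundsAtV7S_zero_of_conj {G : GeoConsts} {P : SplitConsts} {Q : EngConsts} {β U μ : ℝ} {K : TrigPolyC4v}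
    (h : KernelNormsV4 L M P Q β U μ K 0 ∧ PairLadderStepAtV7 L M G P Q β U μ K 0 ∧ QuarticValueUVAtS2 L M G P Q β U μ K 0 ∧
      EngineFirstMoments L M G P Q β U μ K 0 ∧ IsoTupleL1AtS L M G P β U μ K 0) :
    EngineBoundsAtV7S L M G P Q β U μ K 0 :=
  ⟨selfEnergySymmetric_all L M β U μ K 0, h.1, h.2.1, fun h1 => absurd h1 (by omega), fun h1 => absurd h1 (by omega),
    h.2.2.1, h.2.2.2.1, h.2.2.2.2⟩

/-! ## The inductive scales -/

/-- **The engine slot at a scale `1 ≤ n` from its analytic clauses**: (E1-v4), (E2-v7) (equivalently its inductive conjunct,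
`pairLadderStepAtV7_of_pos`), (E2″-v6), (E2′-S3), (E4), (E5-S) ⟹ `EngineBoundsAtV7S … n` — (E0) is `selfEnergySymmetric_all` and
(E2′-S2 UV) is vacuous. -/
theorem engineBoundsAtV7S_of_pos {G : GeoConsts} {P : SplitConsts} {Q : EngConsts} {β U μ : ℝ} {K : TrigPolyC4v} {n : ℕ}
    (hn : 1 ≤ n) (hE1 : KernelNormsV4 L M P Q β U μ K n) (hE2 : PairLadderStepAtV7 L M G P Q β U μ K n)
    (hE2'' : PairValueIncrementAtV6 L M G P Q β U μ K n) (hE2' : QuarticValueIncrementAtS3 L M G P Q β U μ K n)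
    (hE4 : EngineFirstMoments L M G P Q β U μ K n) (hE5 : IsoTupleL1AtS L M G P β U μ K n) :
    EngineBoundsAtV7S L M G P Q β U μ K n :=
  ⟨selfEnergySymmetric_all L M β U μ K n, hE1, hE2, hE2'', hE2', fun h0 => absurd h0 (by omega), hE4, hE5⟩

/-- **`EngineBoundsAtV7S … n` ⟺ its six analytic clauses at `1 ≤ n`** ((E0) and (E2′-S2 UV) drop out). -/
theorem engineBoundsAtV7S_iff_of_pos (G : GeoConsts) (P : SplitConsts) (Q : EngConsts) (β U μ : ℝ) (K : TrigPolyC4v) {n : ℕ}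
    (hn : 1 ≤ n) :
    EngineBoundsAtV7S L M G P Q β U μ K n ↔
      KernelNormsV4 L M P Q β U μ K n ∧ PairLadderStepAtV7 L M G P Q β U μ K n ∧ PairValueIncrementAtV6 L M G P Q β U μ K n ∧
        QuarticValueIncrementAtS3 L M G P Q β U μ K n ∧ EngineFirstMoments L M G P Q β U μ K n ∧ IsoTupleL1AtS L M G P β U μ K n := by
  constructor
  · exact fun h => ⟨h.2.1, h.2.2.1, h.2.2.2.1, h.2.2.2.2.1, h.2.2.2.2.2.2.1, h.2.2.2.2.2.2.2⟩
  · exact fun h => engineBoundsAtV7S_of_pos hn h.1 h.2.1 h.2.2.1 h.2.2.2.1 h.2.2.2.2.1 h.2.2.2.2.2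

/-- **At every scale, (E0) and (E2′-S2 UV) are never owed**: `EngineBoundsAtV7S … n` from the six remaining clauses, uniformly in `n`
(the form a strong induction over the scale ladder reads). -/
theorem engineBoundsAtV7S_of_clauses {G : GeoConsts} {P : SplitConsts} {Q : EngConsts} {β U μ : ℝ} {K : TrigPolyC4v} {n : ℕ}
    (hE1 : KernelNormsV4 L M P Q β U μ K n) (hE2 : PairLadderStepAtV7 L M G P Q β U μ K n)
    (hE2'' : PairValueIncrementAtV6 L M G P Q β U μ K n) (hE2' : QuarticValueIncrementAtS3 L M G P Q β U μ K n)
    (hE4 : EngineFirstMoments L M G P Q β U μ K n) (hE5 : IsoTupleL1AtS L M G P β U μ K n) :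
    EngineBoundsAtV7S L M G P Q β U μ K n :=
  ⟨selfEnergySymmetric_all L M β U μ K n, hE1, hE2, hE2'', hE2', quarticValueUVAtS2_of_pairLadderStepAtV7 hE2, hE4, hE5⟩

end Model

end Summit.HubbardSuperconductivity.HubbardSuperconductivity.Theorems.KLRegimeSplit

end
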